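import Summits.HubbardSuperconductivity.HubbardSuperconductivity.Theorems.ChiralWindowCwThesisPenaltyResponseLRO
import HarnessLib

/-!
# Route `ThermalWedge`, crux `TwTipContinuation` (stmt-HubbardSuperconductivity-1700): the STRATEGIST'S
# SPLIT into the shared Kohn–Luttinger mechanism and a certified in-window `B₁g` datum

Crux-strategist decomposition (unit `cstrat-stmt-HubbardSuperconductivity-1700`).  By the landed
normal form `twTipContinuation_iff_uniformSummitWindow` (p85630) the crux `TwTipContinuation` IS the
`U`-uniform window of the summit matrix at one doping `δ ∈ [1/10, 2/5]` (weak-coupling every-ground-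
state `d_{x²-y²}` pair-field long-range order of the pure repulsive 2D Hubbard torus).  Every line
registered on the crux died at a stub of exactly that class (isogap: `stub_penaltyTransport`;
moments: `stub_groundAverageOrder`; sharp sandwich: `stub_thermalPenalty`).  The one typed division of
the crux whose pieces are NOT the crux reworded is the Kohn–Luttinger structure MECHANISM + DATUM:

* `Sub₁` = the body, word for word, of `TorusCooperLog.KLCanonical` (stmt-HubbardSuperconductivity-2681,
  the research programme of route `TorusCooperLog`, staffed there): at every doping `δ ∈ (0,1/2)` at
  which the second-order pairing vertex has `B₁g` attractive and strictly leading every other `D₄`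
  channel by `γU²`, the canonical pair-penalty response `c·κ ≤ E_L(U;κ) − E_L(U;0)` holds eventually
  along `L = 2(k+1)` for all small `U`;
* `Sub₂` = `CertB1gWedge`: that datum at SOME `δ ∈ [1/10, 2/5]` (the item `TorusCooperLog.CertB1g`,
  stmt-HubbardSuperconductivity-2682, pins `δ` only in `(0,1/2)`; its suggested certificate window
  `[0.15, 0.25]` lies inside `[1/10, 2/5]`, so ONE interval-arithmetic certificate closes both) — a
  certified COMPUTATION, not an analytic open problem;
* conclusion = the body, word for word, of `ThermalWedge.TwTipContinuation`.

This module is deliberately ROUTE-FILE-FREE with respect to `Theses/ThermalWedge.lean` (it does not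
import it, directly or transitively), so the gate can use `twTipContinuation_of_subs` as the glue of a
`route edit --split TwTipContinuation` (`--glue-by`); the same implication with the named constants is
`CrossRoute.twTipContinuation_of_klCanonical` (p92871), whose module imports the route file and can
therefore not be linked from it.  Proof: pure logic on top of the landed support theorem
`Theorems.CwThesis.stub_penaltyResponseLRO` (= `TorusCooperLog.PenaltyResponseLRO`,
stmt-HubbardSuperconductivity-10879): the datum gives `δ`, `Sub₁` at that `δ` gives `U₀` and the
eventual penalty response for every `U ∈ (0, U₀)`, the support theorem turns it into the summit
matrix at `(U, δ)`, and the crux follows with `U₁ := U₀/2` (its seeded `RUNG` hypothesis is idle, as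
p85630 showed it must be).  Kohn–Luttinger, Phys. Rev. Lett. 15 (1965) 524; Raghu–Kivelson–Scalapino,
Phys. Rev. B 81 (2010) 224505 §III; Scalapino, Phys. Rep. 250 (1995) §2 eq. (2.4). [folklore]
-/

noncomputable section

namespace Summit.HubbardSuperconductivity.HubbardSuperconductivity.Theorems.TwTipContinuationSplit

-- `dupNamespace`: the summit and the problem are both named `HubbardSuperconductivity` (layout D-0022)
set_option linter.dupNamespace false

open scoped Matrix ComplexOrder

/-- **Strategist's split of `ThermalWedge.TwTipContinuation`** (stmt-HubbardSuperconductivity-1700):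
`Sub₁ → Sub₂ → TwTipContinuation` with `Sub₁` = the body of `TorusCooperLog.KLCanonical`
(stmt-HubbardSuperconductivity-2681) verbatim, `Sub₂` = `CertB1gWedge` (the Kohn–Luttinger `B₁g`
datum at some `δ ∈ [1/10,2/5]`), conclusion = the body of `ThermalWedge.TwTipContinuation` verbatim.
Pure logic over `Theorems.CwThesis.stub_penaltyResponseLRO` (stmt-HubbardSuperconductivity-10879).
Raghu–Kivelson–Scalapino, PRB 81 (2010) 224505 §III (the `B₁g` window at `t' = 0`). [folklore] -/
theorem twTipContinuation_of_subs :
    (∀ δ ∈ Set.Ioo (0:ℝ) (1 / 2), (∃ γ U₁ : ℝ, 0 < γ ∧ 0 < U₁ ∧ ∀ U ∈ Set.Ioo (0:ℝ) U₁, Literature.MathematicalPhysics.QuantumLattice.channelInf (Literature.MathematicalPhysics.QuantumLattice.squareDispersion 1 0) (Literature.MathematicalPhysics.QuantumLattice.chemicalPotentialOfDensity (Literature.MathematicalPhysics.QuantumLattice.squareDispersion 1 0) (1 - δ)) U Literature.MathematicalPhysics.QuantumLattice.D4Irrep.B1g ≤ -(γ * U ^ 2) ∧ ∀ χ : Literature.MathematicalPhysics.QuantumLattice.D4Irrep,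 χ ≠ Literature.MathematicalPhysics.QuantumLattice.D4Irrep.B1g → Literature.MathematicalPhysics.QuantumLattice.channelInf (Literature.MathematicalPhysics.QuantumLattice.squareDispersion 1 0) (Literature.MathematicalPhysics.QuantumLattice.chemicalPotentialOfDensity (Literature.MathematicalPhysics.QuantumLattice.squareDispersion 1 0) (1 - δ)) U Literature.MathematicalPhysics.QuantumLattice.D4Irrep.B1g + γ * U ^ 2 ≤ Literature.MathematicalPhysics.QuantumLattice.channelInf (Literature.MathematicalPhysics.QuantumLattice.squareDispersion 1 0) (Literature.MathematicalPhysics.QuantumLattice.chemicalPotentialOfDensity (Literature.MathematicalPhysics.QuantumLattice.squareDispersion 1 0) (1 - δ)) U χ) → ∃ U₀ : ℝ, 0 < U₀ ∧ ∀ U ∈ Set.Ioo (0:ℝ) U₀, ∃ κ : ℝ, 0 < κ ∧ ∃ c : ℝ, 0 < c ∧ ∀ᶠ k : ℕ in Filter.atTop, c * κ ≤ Matrix.minEnergyOn (Literature.MathematicalPhysics.QuantumLattice.hubbardTorus 2 (2 * (k + 1)) 1 U + ((κ / ((2 * (k + 1) : ℕ) : ℝ) ^ 4 : ℝ) : ℂ)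 • ((Literature.MathematicalPhysics.QuantumLattice.pairField Literature.MathematicalPhysics.QuantumLattice.dWaveFormFactor (2 * (k + 1)))ᴴ * Literature.MathematicalPhysics.QuantumLattice.pairField Literature.MathematicalPhysics.QuantumLattice.dWaveFormFactor (2 * (k + 1)))) (Literature.MathematicalPhysics.QuantumLattice.szSector (2 * ⌊(1 - δ) * ((2 * (k + 1) : ℕ) : ℝ) ^ 2 / 2⌋₊) 0) - Matrix.minEnergyOn (Literature.MathematicalPhysics.QuantumLattice.hubbardTorus 2 (2 * (k + 1)) 1 U) (Literature.MathematicalPhysics.QuantumLattice.szSector (2 * ⌊(1 - δ) * ((2 * (k + 1) : ℕ) : ℝ) ^ 2 / 2⌋₊) 0)) →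
    (∃ δ ∈ Set.Icc (1 / 10 : ℝ) (2 / 5), ∃ γ U₁ : ℝ, 0 < γ ∧ 0 < U₁ ∧ ∀ U ∈ Set.Ioo (0:ℝ) U₁, Literature.MathematicalPhysics.QuantumLattice.channelInf (Literature.MathematicalPhysics.QuantumLattice.squareDispersion 1 0) (Literature.MathematicalPhysics.QuantumLattice.chemicalPotentialOfDensity (Literature.MathematicalPhysics.QuantumLattice.squareDispersion 1 0) (1 - δ)) U Literature.MathematicalPhysics.QuantumLattice.D4Irrep.B1g ≤ -(γ * U ^ 2) ∧ ∀ χ : Literature.MathematicalPhysics.QuantumLattice.D4Irrep, χ ≠ Literature.MathematicalPhysics.QuantumLattice.D4Irrep.B1g → Literature.MathematicalPhysics.QuantumLattice.channelInf (Literature.MathematicalPhysics.QuantumLattice.squareDispersion 1 0) (Literature.MathematicalPhysics.QuantumLattice.chemicalPotentialOfDensity (Literature.MathematicalPhysics.QuantumLattice.squareDispersion 1 0) (1 - δ)) U Literature.MathematicalPhysics.QuantumLattice.D4Irrep.B1g + γ * U ^ 2 ≤ Literature.MathematicalPhysics.QuantumLattice.channelInf (Literature.MathematicalPhysics.QuantumLattice.squareDispersion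 1 0) (Literature.MathematicalPhysics.QuantumLattice.chemicalPotentialOfDensity (Literature.MathematicalPhysics.QuantumLattice.squareDispersion 1 0) (1 - δ)) U χ) →
    (∃ U₁ : ℝ, 0 < U₁ ∧ ∃ δ ∈ Set.Icc (1/10 : ℝ) (2/5 : ℝ), ∀ U ∈ Set.Ioc (0 : ℝ) U₁, ∀ K : ℝ, 0 < K → K * U ≤ 1 / 20 → (∀ g ∈ Set.Icc (K * U) (1 / 10), ∃ c : ℝ, 0 < c ∧ ∃ L₀ : ℕ, ∀ (L : ℕ) [NeZero L], L₀ ≤ L → Even L → ∀ (ψ : Literature.MathematicalPhysics.QuantumLattice.Fock (Literature.MathematicalPhysics.QuantumLattice.Orb (Literature.MathematicalPhysics.QuantumLattice.FermionTorus 2 L))), star ψ ⬝ᵥ ψ = 1 → Literature.MathematicalPhysics.QuantumLattice.IsGroundStateInSector (Literature.MathematicalPhysics.QuantumLattice.hubbardTorus 2 L 1 U - ((g / (L : ℝ) ^ 2 : ℝ) : ℂ) • ((Literature.MathematicalPhysics.QuantumLattice.pairField Literature.MathematicalPhysics.QuantumLattice.dWaveFormFactor L)ᴴ * Literature.MathematicalPhysics.QuantumLattice.pairField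 Literature.MathematicalPhysics.QuantumLattice.dWaveFormFactor L)) (2 * ⌊(1 - δ) * (L : ℝ) ^ 2 / 2⌋₊) 0 ψ → c * (L : ℝ) ^ 4 ≤ (Literature.MathematicalPhysics.QuantumLattice.expect ((Literature.MathematicalPhysics.QuantumLattice.pairField Literature.MathematicalPhysics.QuantumLattice.dWaveFormFactor L)ᴴ * Literature.MathematicalPhysics.QuantumLattice.pairField Literature.MathematicalPhysics.QuantumLattice.dWaveFormFactor L) ψ).re) → (∀ (N : ℕ → ℕ) (ψ : ∀ L, Literature.MathematicalPhysics.QuantumLattice.Fock (Literature.MathematicalPhysics.QuantumLattice.Orb (Literature.MathematicalPhysics.QuantumLattice.FermionTorus 2 L))), (∀ L, Even L → N L = 2 * ⌊(1 - δ) * (L : ℝ) ^ 2 / 2⌋₊ ∧ star (ψ L) ⬝ᵥ ψ L = 1 ∧ Literature.MathematicalPhysics.QuantumLattice.IsGroundStateInSector (Literature.MathematicalPhysics.QuantumLattice.hubbardTorus 2 L 1 U) (N L) 0 (ψ L)) → Literature.Probability.LatticeModels.HasLongRangeOrder (fun k => Literature.Probability.LatticeModels.halfOpenBox 2 (2 *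 k)) (fun k => Literature.MathematicalPhysics.QuantumLattice.torusPullback (Literature.MathematicalPhysics.QuantumLattice.pairFieldCorr Literature.MathematicalPhysics.QuantumLattice.dWaveFormFactor ψ) (2 * k)))) := by
  rintro hKL ⟨δ, hδ, hd⟩
  have hδ' : δ ∈ Set.Ioo (0 : ℝ) (1 / 2) := ⟨by linarith [hδ.1], by linarith [hδ.2]⟩
  obtain ⟨U₀, hU₀, hresp⟩ := hKL δ hδ' hd
  refine ⟨U₀ / 2, half_pos hU₀, δ, ?_, fun U hU K _hK _hKU _hRung => ?_⟩
  · exact ⟨by norm_num at hδ ⊢; linarith [hδ.1], by norm_num at hδ ⊢; linarith [hδ.2]⟩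
  · have hU' : U ∈ Set.Ioo (0 : ℝ) U₀ := ⟨hU.1, lt_of_le_of_lt hU.2 (half_lt_self hU₀)⟩
    obtain ⟨κ, hκ, c, hc, hev⟩ := hresp U hU'
    exact Summit.HubbardSuperconductivity.HubbardSuperconductivity.Theorems.CwThesis.stub_penaltyResponseLRO
      U δ κ c hκ hc hev

end Summit.HubbardSuperconductivity.HubbardSuperconductivity.Theorems.TwTipContinuationSplit

end
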